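import Summits.HubbardSuperconductivity.HubbardSuperconductivity.Theorems.NodalWardXYVisonPairCostSymbolDefs
import Summits.HubbardSuperconductivity.HubbardSuperconductivity.Theorems.NodalWardXYVisonPairCostFreeResolventDecay

/-!
# Crux `VisonPairCost` (stmt-HubbardSuperconductivity-1266), line `Sketch`: assembly of the symbol bounds

`stub_symbolAssembly : SymbDerivBounds → LineIntegralBounds → GridSumBounds → SymbolIntegralBounds` — the last registered
stub of the log-determinant line.  Pure bookkeeping: the grid-line integrals `colPhi1/2`, `rowPhi1/2` of the first/second
momentum derivative of the free `d`-wave BdG symbol are bounded by (pointwise derivative bound) × (line integral of `1/D`,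
`1/(D√D)`) summed over the momentum grid; the row direction is the column direction by the `k₁ ↔ k₂` swap symmetry of the
norms of the derivatives.  Result: `Φ₁ ≤ C(1 + |log t|)`, `Φ₂ ≤ C/t` on `t ∈ [1/L, t₀]`, uniformly in `L ≥ 4`.
-/

noncomputable section

-- tree namespace Summit.HubbardSuperconductivity.HubbardSuperconductivity (D-0017)
set_option linter.dupNamespace false

namespace Summit.HubbardSuperconductivity.HubbardSuperconductivity.Theorems.VisonPairCost

open Summit.HubbardSuperconductivity.HubbardSuperconductivity.Theses.NodalWardXY
open MeasureTheory intervalIntegral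

/-- `symbDen` is continuous in the first momentum. -/
theorem sa_continuous_symbDen_left (μ Δ₀ t r : ℝ) : Continuous fun k => symbDen μ Δ₀ t k r := by
  unfold symbDen xiS gapS
  fun_prop

/-- `symbDen ≥ t²`, in particular positive for `t ≠ 0`. -/
theorem sa_symbDen_pos {μ Δ₀ t : ℝ} (ht : 0 < t) (k r : ℝ) : 0 < symbDen μ Δ₀ t k r := by
  unfold symbDen
  have : 0 < t ^ 2 := by positivity
  nlinarith [sq_nonneg (xiS μ k r), sq_nonneg (gapS Δ₀ k r)]

/-- Elementary: `1 + |log t| ≤ t₀ (1 + log t₀) / t` for `0 < t ≤ t₀`, `1 ≤ t₀`. -/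
theorem sa_one_add_abs_log_le {t t₀ : ℝ} (ht : 0 < t) (htt : t ≤ t₀) (ht₀ : 1 ≤ t₀) :
    1 + |Real.log t| ≤ t₀ * (1 + Real.log t₀) / t := by
  have hlog₀ : 0 ≤ Real.log t₀ := Real.log_nonneg ht₀
  rw [le_div_iff₀ ht]
  rcases le_or_gt t 1 with h1 | h1
  · -- `t ≤ 1`: `|log t| = -log t = log (1/t) ≤ 1/t - 1`
    have hlt : Real.log t ≤ 0 := Real.log_nonpos ht.le h1
    rw [abs_of_nonpos hlt]
    have hinv : Real.log t⁻¹ ≤ t⁻¹ - 1 := Real.log_le_sub_one_of_pos (inv_pos.mpr ht)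
    rw [Real.log_inv] at hinv
    have hti : t * t⁻¹ = 1 := mul_inv_cancel₀ ht.ne'
    have : (1 + -Real.log t) * t ≤ 1 := by nlinarith
    calc (1 + -Real.log t) * t ≤ 1 := this
      _ ≤ t₀ * (1 + Real.log t₀) := by nlinarith
  · -- `1 < t ≤ t₀`
    have hlt : 0 ≤ Real.log t := Real.log_nonneg h1.le
    rw [abs_of_nonneg hlt]
    have hmono : Real.log t ≤ Real.log t₀ := Real.log_le_log ht htt
    have : (1 + Real.log t) * t ≤ (1 + Real.log t₀) * t₀ := by
      apply mul_le_mul (by linarith) htt ht.le (by linarith)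
    linarith

/-- **The last stub of the line**: the three symbol estimates give `SymbolIntegralBounds`. -/
theorem stub_symbolAssembly : SymbDerivBounds → LineIntegralBounds → GridSumBounds → SymbolIntegralBounds := by
  intro hD hLI hG μ hμ _hμ0 Δ₀ hΔ₀ t₀ ht₀
  obtain ⟨CD, hCD0, hCD⟩ := hD μ Δ₀
  obtain ⟨CL, hCL0, hCL⟩ := hLI μ hμ Δ₀ hΔ₀
  obtain ⟨CG, hCG0, hCG⟩ := hG μ hμ Δ₀ hΔ₀ t₀ ht₀
  -- the constant
  set K : ℝ := t₀ * (1 + Real.log t₀) with hK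
  have hK1 : 1 ≤ K := by
    have : 0 ≤ Real.log t₀ := Real.log_nonneg ht₀
    rw [hK]; nlinarith
  refine ⟨4 * CD * CL * CG * (K + 1), by positivity, ?_⟩
  intro L _ hL t hLt htt₀
  have hLpos : (0 : ℝ) < L := by exact_mod_cast (show 0 < L by omega)
  have ht : 0 < t := lt_of_lt_of_le (by positivity) hLt
  have h2π : (0 : ℝ) ≤ 2 * Real.pi := by positivity
  -- grid sums
  obtain ⟨hG1, hG2⟩ := hCG L hL t hLt htt₀
  set ε : Fin L → ℝ := fun j => lineEps μ Δ₀ t (2 * Real.pi * (j : ℝ) / L) with hε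
  have hεpos : ∀ j, 0 < ε j := fun j => by
    simp only [hε, lineEps]
    apply Real.sqrt_pos.mpr
    have : 0 < t ^ 2 := by positivity
    have : 0 ≤ coneSq Δ₀ * (Real.cos (2 * Real.pi * (j : ℝ) / L) + μ / 4) ^ 2 := by
      unfold coneSq; positivity
    linarith
  -- (1) per grid line and per entry: the two integral bounds in the column direction
  have hline1 : ∀ (j : Fin L) (σ σ' : Fin 2),
      (∫ k in (0 : ℝ)..(2 * Real.pi), ‖deriv (fun s => symb μ Δ₀ t s (2 * Real.pi * (j : ℝ) / L) σ σ') k‖) ≤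
        CD * CL / ε j := by
    intro j σ σ'
    set r : ℝ := 2 * Real.pi * (j : ℝ) / L with hr
    have hcd := symb_contDiff_left μ Δ₀ ht.ne' r σ σ'
    have hcont : Continuous fun k => ‖deriv (fun s => symb μ Δ₀ t s r σ σ') k‖ :=
      (hcd.continuous_deriv (by norm_num)).norm
    have hcontD : Continuous fun k => CD / symbDen μ Δ₀ t k r :=
      continuous_const.div (sa_continuous_symbDen_left μ Δ₀ t r) fun k => (sa_symbDen_pos ht k r).ne'
    calc (∫ k in (0 : ℝ)..(2 * Real.pi), ‖deriv (fun s => symb μ Δ₀ t s r σ σ') k‖)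
        ≤ ∫ k in (0 : ℝ)..(2 * Real.pi), CD / symbDen μ Δ₀ t k r := by
          refine intervalIntegral.integral_mono_on h2π (hcont.intervalIntegrable _ _) (hcontD.intervalIntegrable _ _) ?_
          intro k _
          exact (hCD t ht k r σ σ').1
      _ = CD * ∫ k in (0 : ℝ)..(2 * Real.pi), 1 / symbDen μ Δ₀ t k r := by
          rw [← intervalIntegral.integral_const_mul]
          congr 1; funext k; rw [mul_one_div]
      _ ≤ CD * (CL / lineEps μ Δ₀ t r) :=
          mul_le_mul_of_nonneg_left (hCL t ht r).1 hCD0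
      _ = CD * CL / ε j := by rw [hε]; ring
  have hline2 : ∀ (j : Fin L) (σ σ' : Fin 2),
      (∫ k in (0 : ℝ)..(2 * Real.pi),
          ‖iteratedDeriv 2 (fun s => symb μ Δ₀ t s (2 * Real.pi * (j : ℝ) / L) σ σ') k‖) ≤
        CD * CL * (1 / ε j + 1 / ε j ^ 2) := by
    intro j σ σ'
    set r : ℝ := 2 * Real.pi * (j : ℝ) / L with hr
    have hcd := symb_contDiff_left μ Δ₀ ht.ne' r σ σ'
    have hcont : Continuous fun k => ‖iteratedDeriv 2 (fun s => symb μ Δ₀ t s r σ σ') k‖ :=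
      (hcd.continuous_iteratedDeriv 2 (le_refl _)).norm
    have hDc := sa_continuous_symbDen_left μ Δ₀ t r
    have hDne : ∀ k, symbDen μ Δ₀ t k r ≠ 0 := fun k => (sa_symbDen_pos ht k r).ne'
    have hDsne : ∀ k, symbDen μ Δ₀ t k r * Real.sqrt (symbDen μ Δ₀ t k r) ≠ 0 := fun k =>
      mul_ne_zero (hDne k) (Real.sqrt_ne_zero'.mpr (sa_symbDen_pos ht k r))
    have hcontR : Continuous fun k =>
        CD * (1 / symbDen μ Δ₀ t k r + 1 / (symbDen μ Δ₀ t k r * Real.sqrt (symbDen μ Δ₀ t k r))) := by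
      refine continuous_const.mul (Continuous.add ?_ ?_)
      · exact continuous_const.div hDc hDne
      · exact continuous_const.div (hDc.mul hDc.sqrt) hDsne
    have hc1 : Continuous fun k => 1 / symbDen μ Δ₀ t k r := continuous_const.div hDc hDne
    have hc2 : Continuous fun k => 1 / (symbDen μ Δ₀ t k r * Real.sqrt (symbDen μ Δ₀ t k r)) :=
      continuous_const.div (hDc.mul hDc.sqrt) hDsne
    calc (∫ k in (0 : ℝ)..(2 * Real.pi), ‖iteratedDeriv 2 (fun s => symb μ Δ₀ t s r σ σ') k‖)
        ≤ ∫ k in (0 : ℝ)..(2 * Real.pi),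
            CD * (1 / symbDen μ Δ₀ t k r + 1 / (symbDen μ Δ₀ t k r * Real.sqrt (symbDen μ Δ₀ t k r))) := by
          refine intervalIntegral.integral_mono_on h2π (hcont.intervalIntegrable _ _) (hcontR.intervalIntegrable _ _) ?_
          intro k _
          exact (hCD t ht k r σ σ').2.1
      _ = CD * ((∫ k in (0 : ℝ)..(2 * Real.pi), 1 / symbDen μ Δ₀ t k r) +
            ∫ k in (0 : ℝ)..(2 * Real.pi), 1 / (symbDen μ Δ₀ t k r * Real.sqrt (symbDen μ Δ₀ t k r))) := by
          rw [intervalIntegral.integral_const_mul,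
            intervalIntegral.integral_add (hc1.intervalIntegrable _ _) (hc2.intervalIntegrable _ _)]
      _ ≤ CD * (CL / lineEps μ Δ₀ t r + CL / lineEps μ Δ₀ t r ^ 2) :=
          mul_le_mul_of_nonneg_left (add_le_add (hCL t ht r).1 (hCL t ht r).2) hCD0
      _ = CD * CL * (1 / ε j + 1 / ε j ^ 2) := by rw [hε]; ring
  -- (2) sum over the four entries and over the grid
  have hsum1 : ∑ j : Fin L, ∑ σ : Fin 2, ∑ σ' : Fin 2,
      (∫ k in (0 : ℝ)..(2 * Real.pi), ‖deriv (fun s => symb μ Δ₀ t s (2 * Real.pi * (j : ℝ) / L) σ σ') k‖) ≤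
        4 * CD * CL * ∑ j : Fin L, 1 / ε j := by
    rw [Finset.mul_sum]
    refine Finset.sum_le_sum fun j _ => ?_
    calc ∑ σ : Fin 2, ∑ σ' : Fin 2,
          (∫ k in (0 : ℝ)..(2 * Real.pi), ‖deriv (fun s => symb μ Δ₀ t s (2 * Real.pi * (j : ℝ) / L) σ σ') k‖)
        ≤ ∑ _σ : Fin 2, ∑ _σ' : Fin 2, CD * CL / ε j :=
          Finset.sum_le_sum fun σ _ => Finset.sum_le_sum fun σ' _ => hline1 j σ σ'
      _ = 4 * CD * CL * (1 / ε j) := by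
          simp only [Finset.sum_const, Finset.card_univ, Fintype.card_fin]
          ring
  have hsum2 : ∑ j : Fin L, ∑ σ : Fin 2, ∑ σ' : Fin 2,
      (∫ k in (0 : ℝ)..(2 * Real.pi),
          ‖iteratedDeriv 2 (fun s => symb μ Δ₀ t s (2 * Real.pi * (j : ℝ) / L) σ σ') k‖) ≤
        4 * CD * CL * (∑ j : Fin L, 1 / ε j + ∑ j : Fin L, 1 / ε j ^ 2) := by
    rw [← Finset.sum_add_distrib, Finset.mul_sum]
    refine Finset.sum_le_sum fun j _ => ?_
    calc ∑ σ : Fin 2, ∑ σ' : Fin 2,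
          (∫ k in (0 : ℝ)..(2 * Real.pi),
            ‖iteratedDeriv 2 (fun s => symb μ Δ₀ t s (2 * Real.pi * (j : ℝ) / L) σ σ') k‖)
        ≤ ∑ _σ : Fin 2, ∑ _σ' : Fin 2, CD * CL * (1 / ε j + 1 / ε j ^ 2) :=
          Finset.sum_le_sum fun σ _ => Finset.sum_le_sum fun σ' _ => hline2 j σ σ'
      _ = 4 * CD * CL * (1 / ε j + 1 / ε j ^ 2) := by
          simp only [Finset.sum_const, Finset.card_univ, Fintype.card_fin]
          ring
  -- (3) the row direction equals the column direction (swap symmetry of the norms)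
  have hrow1 : rowPhi1 L μ Δ₀ t = colPhi1 L μ Δ₀ t := by
    unfold rowPhi1 colPhi1
    congr 1
    refine Finset.sum_congr rfl fun j _ => Finset.sum_congr rfl fun σ _ => Finset.sum_congr rfl fun σ' _ => ?_
    refine intervalIntegral.integral_congr fun k _ => ?_
    exact (hCD t ht k (2 * Real.pi * (j : ℝ) / L) σ σ').2.2.1
  have hrow2 : rowPhi2 L μ Δ₀ t = colPhi2 L μ Δ₀ t := by
    unfold rowPhi2 colPhi2
    congr 1
    refine Finset.sum_congr rfl fun j _ => Finset.sum_congr rfl fun σ _ => Finset.sum_congr rfl fun σ' _ => ?_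
    refine intervalIntegral.integral_congr fun k _ => ?_
    exact (hCD t ht k (2 * Real.pi * (j : ℝ) / L) σ σ').2.2.2
  -- (4) the column bounds
  have hL0 : (0 : ℝ) ≤ 1 / (L : ℝ) := by positivity
  have hlog0 : 0 ≤ 1 + |Real.log t| := by positivity
  have hcol1 : colPhi1 L μ Δ₀ t ≤ 4 * CD * CL * CG * (K + 1) * (1 + |Real.log t|) := by
    unfold colPhi1
    calc 1 / (L : ℝ) * ∑ j : Fin L, ∑ σ : Fin 2, ∑ σ' : Fin 2,
          (∫ k in (0 : ℝ)..(2 * Real.pi), ‖deriv (fun s => symb μ Δ₀ t s (2 * Real.pi * (j : ℝ) / L) σ σ') k‖)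
        ≤ 1 / (L : ℝ) * (4 * CD * CL * ∑ j : Fin L, 1 / ε j) := mul_le_mul_of_nonneg_left hsum1 hL0
      _ = 4 * CD * CL * (1 / (L : ℝ) * ∑ j : Fin L, 1 / ε j) := by ring
      _ ≤ 4 * CD * CL * (CG * (1 + |Real.log t|)) := mul_le_mul_of_nonneg_left hG1 (by positivity)
      _ = 4 * CD * CL * CG * 1 * (1 + |Real.log t|) := by ring
      _ ≤ 4 * CD * CL * CG * (K + 1) * (1 + |Real.log t|) := by
          apply mul_le_mul_of_nonneg_right _ hlog0
          apply mul_le_mul_of_nonneg_left _ (by positivity)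
          linarith
  have hlogK : 1 + |Real.log t| ≤ K / t := sa_one_add_abs_log_le ht htt₀ ht₀
  have hcol2 : colPhi2 L μ Δ₀ t ≤ 4 * CD * CL * CG * (K + 1) / t := by
    unfold colPhi2
    calc 1 / (L : ℝ) * ∑ j : Fin L, ∑ σ : Fin 2, ∑ σ' : Fin 2,
          (∫ k in (0 : ℝ)..(2 * Real.pi),
            ‖iteratedDeriv 2 (fun s => symb μ Δ₀ t s (2 * Real.pi * (j : ℝ) / L) σ σ') k‖)
        ≤ 1 / (L : ℝ) * (4 * CD * CL * (∑ j : Fin L, 1 / ε j + ∑ j : Fin L, 1 / ε j ^ 2)) :=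
          mul_le_mul_of_nonneg_left hsum2 hL0
      _ = 4 * CD * CL * ((1 / (L : ℝ) * ∑ j : Fin L, 1 / ε j) + (1 / (L : ℝ) * ∑ j : Fin L, 1 / ε j ^ 2)) := by
          ring
      _ ≤ 4 * CD * CL * (CG * (1 + |Real.log t|) + CG / t) :=
          mul_le_mul_of_nonneg_left (add_le_add hG1 hG2) (by positivity)
      _ ≤ 4 * CD * CL * (CG * (K / t) + CG / t) := by
          apply mul_le_mul_of_nonneg_left _ (by positivity)
          exact add_le_add (mul_le_mul_of_nonneg_left hlogK hCG0) le_rfl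
      _ = 4 * CD * CL * CG * (K + 1) / t := by field_simp
  exact ⟨hcol1, hcol2, hrow1 ▸ hcol1, hrow2 ▸ hcol2⟩

end Summit.HubbardSuperconductivity.HubbardSuperconductivity.Theorems.VisonPairCost

end
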